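import Literature.NumberTheory.Sieve.HeathBrownCubicETermRearrangement
import Literature.NumberTheory.Sieve.HeathBrownCubicIdealMoebius
import Literature.NumberTheory.LFunctions.IdealMoebiusCoprime
import HarnessLib

/-!
# Heath-Brown's `Σ(x; 𝔠) = ∑_{N(A) < x, (A, 𝔠) = 1} μ(A) log(x/N(A))/N(A)` evaluated (p. 51), for `K = ℚ(2^{1/3})`

Bridge file (proofs only; no definitions, no named facts) in the decomposition of **parity.S18**
(`Literature.NumberTheory.Sieve.setOf_prime_cube_add_two_mul_cube_infinite`) along D. R. Heath-Brown,
*Primes represented by `x³ + 2y³`*, Acta Math. 186 (2001), 1–84, inside the proof of **Lemma 8.1**.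
`HeathBrownCubicETermMainTerm` reduces the main term of Lemma 8.1, via (8.7), to the Möbius sums
`Σ(x; 𝔮) = ∑_{N(A) < x, A + 𝔮 = (1)} μ(A) log(x/N(A))/N(A)` and records that their evaluation
"`γ₀⁻¹N(𝔮)/φ_K(𝔮) + O(exp(−c√(log x)))` (Perron's formula and the zero-free region of `ζ_K`, p. 51) is
NOT in this file". That evaluation is PROVED in the general-number-field layer
(`Literature.NumberTheory.LFunctions.NumberField.coprimeMoebius_logRieszMean_bound`,
`IdealMoebiusCoprime.lean`: Perron's formula for logarithmic Riesz means, the classical zero-free region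
of `ζ_K` with `1/ζ_K ≪ log(|t|+4)`, the Dirichlet series `∑_{(B,𝔠)=1}μ(B)N(B)^{-s} = ζ_K(s)^{-1}∏_{P∣𝔠}(1−N(P)^{-s})^{-1}`
and its residue); this file transports it to the vocabulary of the Heath-Brown files:

* `idealMoebius_eq_intCast` — the real-valued `CubicSieve.idealMoebius` of `HeathBrownCubicTypeII` is the
  cast of the integer-valued `Literature.NumberTheory.LFunctions.idealMoebius` of `IdealMoebius.lean`;
* `sigmaSum_eq_sum_Icc` — `Σ(x; 𝔠)` over `smallIdeals x` equals the `ℕ`-grouped sum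
  `∑_{1 ≤ n ≤ x} a_𝔠(n) log(x/n)/n` of `IdealMoebiusCoprime.lean` (the terms `A = 0` and `N(A) = x` vanish);
* **`HeathBrown2001_moebiusSigma_bound`** — Heath-Brown p. 51 ("we may therefore change the path of
  integration in the usual way to obtain `Σ = res{f(s+1)x^s s^{-2} : s = 0} + O(exp{−c√(log x)})` …
  The residue is easily found to be `γ₀^{-1}∏_{P∣C}(1 − N(P)^{-1})^{-1}`"), PROVED uniformly: there are
  `c > 0`, `C > 0` such that for every nonzero ideal `𝔠` of `𝓞_K` and every real `x ≥ 1`,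
  `|Σ(x; 𝔠) − γ₀⁻¹ ∏_{P ∣ 𝔠}(1 − N(P)⁻¹)⁻¹| ≤ C · A^{ω(N(𝔠))} · exp(−c√(log x))`,
  `ω(N(𝔠))` the number of rational primes dividing `N(𝔠)` and `A = A_K ≥ 1` a constant
  (`HeathBrown2001_moebiusSigma_bound'` keeps the sharper factor `B(𝔠) = ∏_{p∣N(𝔠)}∑_e c_K(p^e)p^{-e/2}`).
  Heath-Brown states the error as `O(exp{−c√(log x)})` for `N(C) ≤ x` after noting
  `∏_{P∣C}(…) ≪ exp{c(log N(C))^{1/4}}`; the factor `A^{ω(N(𝔠))} ≤ τ(N(𝔠))^{log₂ A}` here is of the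
  same use in (8.7) (it is absorbed by the `τ(q)^c` of Lemma 8.1).

## References

* D. R. Heath-Brown, *Primes represented by `x³ + 2y³`*, Acta Math. 186 (2001), 1–84: §8, (8.7) and
  p. 51. [cite: HeathBrownActa2001, §8 p. 51]

## Mathlib / tree search

Tree: `CubicSieve.smallIdeals`, `mem_smallIdeals_iff` (`HeathBrownCubicETermRearrangement`),
`CubicSieve.idealMoebius`, `idealMoebius_of_squarefree`, `idealMoebius_of_not_squarefree`
(`HeathBrownCubicIdealMoebius`), `mem_primeFactorsFinset_iff`, `idealsLE`, `gamma₀`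
(`HeathBrownCubicSieveSetup`; `gamma₀ = NumberField.dedekindZeta_residue K` by definition),
`LFunctions.NumberField.coprimeMoebius_logRieszMean_bound`, `sum_Icc_coprimeMoebiusSum_mul_eq`,
`prod_localFactor_le_pow`, `LFunctions.NumberField.idealsOfNorm` (`IdealMoebiusCoprime`, `IdealMoebius`).
Mathlib: `Ideal.mem_normalizedFactors_iff`, `Multiset.toFinset_card_of_nodup`,
`UniqueFactorizationMonoid.squarefree_iff_nodup_normalizedFactors`, `Finset.sum_subset`.
-/

noncomputable section

open NumberField Finset UniqueFactorizationMonoid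

namespace Literature.NumberTheory.Sieve.CubicSieve

open LFunctions.CubeRootTwoField LFunctions.NumberField

/-- The real-valued Möbius function of `HeathBrownCubicTypeII` is the cast of the integer-valued
`Literature.NumberTheory.LFunctions.idealMoebius` (same definition; for square-free `J ≠ 0` the prime
ideal factors `primeFactorsFinset J` are the normalized factors without repetition). [folklore] -/
theorem idealMoebius_eq_intCast (J : Ideal (𝓞 K)) :
    idealMoebius J = (LFunctions.idealMoebius J : ℝ) := by
  classical
  by_cases h : Squarefree J
  · have hJ0 : (J : Ideal (𝓞 K)) ≠ 0 := h.ne_zero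
    have hJ : J ≠ ⊥ := by rwa [Ne, ← Ideal.zero_eq_bot]
    rw [idealMoebius_of_squarefree h, LFunctions.idealMoebius_apply_of_squarefree h]
    push_cast
    congr 1
    have hset : primeFactorsFinset J = (normalizedFactors J).toFinset := by
      ext P
      rw [mem_primeFactorsFinset_iff hJ, Multiset.mem_toFinset, Ideal.mem_normalizedFactors_iff hJ,
        Ideal.dvd_iff_le]
    rw [hset, Multiset.toFinset_card_of_nodup ((squarefree_iff_nodup_normalizedFactors hJ0).1 h)]
  · rw [idealMoebius_of_not_squarefree h, LFunctions.idealMoebius_apply_of_not_squarefree h]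
    simp

open scoped Classical in
/-- **`Σ(x; 𝔠)` as the `ℕ`-grouped sum of `IdealMoebiusCoprime.lean`**: for real `x` and any ideal `𝔠`,
`∑_{N(A) < x, A + 𝔠 = (1)} μ(A) log(x/N(A))/N(A) = ∑_{1 ≤ n ≤ x} a_𝔠(n) · log(x/n)/n`,
`a_𝔠(n) = ∑_{N(B) = n, B + 𝔠 = (1)} μ(B)` (both equal the sum over `N(A) ≤ ⌊x⌋`: the extra terms
have `A = 0`, where `μ = 0`, or `N(A) = x`, where `log(x/N(A)) = 0`). [folklore] -/
theorem sigmaSum_eq_sum_Icc (𝔠 : Ideal (𝓞 K)) (x : ℝ) :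
    ∑ A ∈ (smallIdeals x).filter (fun A ↦ A ⊔ 𝔠 = ⊤),
        idealMoebius A * Real.log (x / Ideal.absNorm A) / Ideal.absNorm A =
      ∑ n ∈ Finset.Icc 1 ⌊x⌋₊,
        ((∑ B ∈ (idealsOfNorm K n).filter (fun B ↦ B ⊔ 𝔠 = ⊤), LFunctions.idealMoebius B : ℤ) : ℝ) *
          (Real.log (x / n) / n) := by
  set F : Ideal (𝓞 K) → ℝ := fun A ↦
    idealMoebius A * Real.log (x / Ideal.absNorm A) / Ideal.absNorm A with hF
  set U : Finset (Ideal (𝓞 K)) := (idealsLE ⌊x⌋₊).filter (fun A ↦ A ⊔ 𝔠 = ⊤) with hU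
  -- the left side as a sum over `U`
  have hL : ∑ A ∈ (smallIdeals x).filter (fun A ↦ A ⊔ 𝔠 = ⊤), F A = ∑ A ∈ U, F A := by
    refine Finset.sum_subset (fun A hA ↦ ?_) (fun A hAU hA ↦ ?_)
    · rw [Finset.mem_filter, mem_smallIdeals_iff] at hA
      rw [hU, Finset.mem_filter, mem_idealsLE]
      exact ⟨Nat.le_floor hA.1.le, hA.2⟩
    · rw [hU, Finset.mem_filter, mem_idealsLE] at hAU
      rw [Finset.mem_filter, mem_smallIdeals_iff, not_and'] at hA
      have hge : x ≤ Ideal.absNorm A := not_lt.1 (hA hAU.2)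
      rcases lt_or_ge x 0 with hx | hx
      · -- `x < 0`: then `⌊x⌋₊ = 0`, so `N(A) = 0`, `A = 0`, `μ(A) = 0`
        have h0 : Ideal.absNorm A = 0 := by
          have := hAU.1; rw [Nat.floor_of_nonpos hx.le] at this; exact Nat.le_zero.1 this
        rw [Ideal.absNorm_eq_zero_iff] at h0
        simp [hF, h0, idealMoebius_bot]
      · have hle : (Ideal.absNorm A : ℝ) ≤ x := (Nat.cast_le.2 hAU.1).trans (Nat.floor_le hx)
        have heq : (Ideal.absNorm A : ℝ) = x := le_antisymm hle hge
        simp only [hF, heq]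
        rcases eq_or_ne x 0 with hx0 | hx0
        · simp [hx0]
        · rw [div_self hx0, Real.log_one, mul_zero, zero_div]
  -- the right side: the `ℕ`-grouped sum as a sum over ideals (`sum_Icc_coprimeMoebiusSum_mul_eq`)
  set G : Ideal (𝓞 K) → ℝ := fun A ↦
    (LFunctions.idealMoebius A : ℝ) * (Real.log (x / Ideal.absNorm A) / Ideal.absNorm A) with hG
  have hR : ∑ n ∈ Finset.Icc 1 ⌊x⌋₊,
      ((∑ B ∈ (idealsOfNorm K n).filter (fun B ↦ B ⊔ 𝔠 = ⊤), LFunctions.idealMoebius B : ℤ) : ℝ) *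
        (Real.log (x / n) / n) =
      ∑ A ∈ ((Finset.Icc 1 ⌊x⌋₊).biUnion (idealsOfNorm K)).filter (fun A ↦ A ⊔ 𝔠 = ⊤), G A := by
    have key := sum_Icc_coprimeMoebiusSum_mul_eq (K := K) 𝔠 (fun n ↦ Real.log (x / n) / n) ⌊x⌋₊
    simp only [zsmul_eq_mul] at key
    exact key
  have hGF : ∀ A, G A = F A := fun A ↦ by
    simp only [hG, hF, idealMoebius_eq_intCast]; ring
  have hsub : ∑ A ∈ ((Finset.Icc 1 ⌊x⌋₊).biUnion (idealsOfNorm K)).filter (fun A ↦ A ⊔ 𝔠 = ⊤), F A =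
      ∑ A ∈ U, F A := by
    refine Finset.sum_subset (fun A hA ↦ ?_) (fun A hAU hA ↦ ?_)
    · rw [Finset.mem_filter, Finset.mem_biUnion] at hA
      obtain ⟨⟨n, hn, hAn⟩, hcop⟩ := hA
      rw [mem_idealsOfNorm] at hAn
      rw [Finset.mem_Icc] at hn
      rw [hU, Finset.mem_filter, mem_idealsLE, hAn]
      exact ⟨hn.2, hcop⟩
    · rw [hU, Finset.mem_filter, mem_idealsLE] at hAU
      rw [Finset.mem_filter, Finset.mem_biUnion, not_and'] at hA
      have h0 : Ideal.absNorm A = 0 := by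
        by_contra h0
        refine hA hAU.2 ⟨Ideal.absNorm A, ?_, by rw [mem_idealsOfNorm]⟩
        rw [Finset.mem_Icc]
        exact ⟨Nat.one_le_iff_ne_zero.2 h0, hAU.1⟩
      rw [Ideal.absNorm_eq_zero_iff] at h0
      simp [hF, h0, idealMoebius_bot]
  calc ∑ A ∈ (smallIdeals x).filter (fun A ↦ A ⊔ 𝔠 = ⊤),
        idealMoebius A * Real.log (x / Ideal.absNorm A) / Ideal.absNorm A
      = ∑ A ∈ U, F A := hL
    _ = ∑ A ∈ ((Finset.Icc 1 ⌊x⌋₊).biUnion (idealsOfNorm K)).filter (fun A ↦ A ⊔ 𝔠 = ⊤), G A := by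
        rw [← hsub]; exact Finset.sum_congr rfl fun A _ ↦ (hGF A).symm
    _ = _ := hR.symm

/-- **Heath-Brown's evaluation of `Σ(x; 𝔠)` (p. 51), with the sharper factor `B(𝔠)`**: there are `c > 0`,
`C > 0` such that for every nonzero ideal `𝔠` of `𝓞_K`, `K = ℚ(2^{1/3})`, and every real `x ≥ 1`,
`|∑_{N(A) < x, A + 𝔠 = (1)} μ(A) log(x/N(A))/N(A) − γ₀⁻¹∏_{P∣𝔠}(1 − N(P)⁻¹)⁻¹| ≤ C · B(𝔠) · exp(−c√(log x))`,
`B(𝔠) = ∏_{p ∣ N(𝔠)} ∑_e c_K(p^e) p^{-e/2}`. [cite: HeathBrownActa2001, §8 p. 51] -/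
theorem HeathBrown2001_moebiusSigma_bound' :
    ∃ c : ℝ, 0 < c ∧ ∃ C : ℝ, 0 < C ∧ ∀ 𝔠 : Ideal (𝓞 K), 𝔠 ≠ ⊥ → ∀ x : ℝ, 1 ≤ x →
      |(∑ A ∈ (smallIdeals x).filter (fun A ↦ A ⊔ 𝔠 = ⊤),
          idealMoebius A * Real.log (x / Ideal.absNorm A) / Ideal.absNorm A) -
          gamma₀⁻¹ * ∏ P ∈ (normalizedFactors 𝔠).toFinset, (1 - (Ideal.absNorm P : ℝ)⁻¹)⁻¹| ≤
        C * (∏ p ∈ (Ideal.absNorm 𝔠).primeFactors,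
              ∑' e : ℕ, (LFunctions.idealNormCount K (p ^ e) : ℝ) * ((p : ℝ) ^ e) ^ (-(1 / 2 : ℝ))) *
          Real.exp (-c * Real.sqrt (Real.log x)) := by
  classical
  obtain ⟨c, hc, C, hC, h⟩ := coprimeMoebius_logRieszMean_bound (K := K)
  refine ⟨c, hc, C, hC, fun 𝔠 h𝔠 x hx ↦ ?_⟩
  have key := h 𝔠 h𝔠 x hx
  rw [sigmaSum_eq_sum_Icc]
  have hcast : (∑ n ∈ Finset.Icc 1 ⌊x⌋₊,
      ((∑ B ∈ (idealsOfNorm K n).filter (fun B ↦ B ⊔ 𝔠 = ⊤), LFunctions.idealMoebius B : ℤ) : ℂ) / n *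
        (Real.log (x / n) : ℂ)) -
      ((∏ P ∈ (normalizedFactors 𝔠).toFinset, (1 - (Ideal.absNorm P : ℝ)⁻¹)⁻¹ : ℝ) : ℂ) /
        (NumberField.dedekindZeta_residue K : ℂ) =
      (((∑ n ∈ Finset.Icc 1 ⌊x⌋₊,
        ((∑ B ∈ (idealsOfNorm K n).filter (fun B ↦ B ⊔ 𝔠 = ⊤), LFunctions.idealMoebius B : ℤ) : ℝ) *
          (Real.log (x / n) / n)) -
        gamma₀⁻¹ * ∏ P ∈ (normalizedFactors 𝔠).toFinset, (1 - (Ideal.absNorm P : ℝ)⁻¹)⁻¹ : ℝ) : ℂ) := by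
    rw [gamma₀]
    push_cast
    congr 1
    · refine Finset.sum_congr rfl fun n _ ↦ ?_
      ring
    · ring
  rw [hcast, Complex.norm_real, Real.norm_eq_abs] at key
  exact key

/-- **Heath-Brown's evaluation of the Möbius sums `Σ(x; 𝔠)` of (8.7)** (Acta Math. 186 (2001), p. 51:
"Using the standard zero-free region for `ζ_K(s)` we may therefore change the path of integration in the
usual way to obtain `Σ = res{f(s+1)x^s s^{-2} : s = 0} + O(exp{−c√(log x)})` for a suitable constant
`c` … The residue is easily found to be `γ₀^{-1}∏_{P∣C}(1 − N(P)^{-1})^{-1}`"), PROVED for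
`K = ℚ(2^{1/3})`, uniformly in the nonzero ideal `𝔠`: there are constants `c > 0`, `C > 0`, `A ≥ 1` with
`|∑_{N(A) < x, A + 𝔠 = (1)} μ(A) log(x/N(A))/N(A) − γ₀⁻¹∏_{P∣𝔠}(1 − N(P)⁻¹)⁻¹| ≤ C · A^{ω(N(𝔠))} · exp(−c√(log x))`
for all real `x ≥ 1`, where `ω(N(𝔠)) = #(N(𝔠)).primeFactors` (so `A^{ω(N(𝔠))} ≤ τ(N(𝔠))^{log₂ A}`).
[cite: HeathBrownActa2001, §8 p. 51] -/
theorem HeathBrown2001_moebiusSigma_bound :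
    ∃ c : ℝ, 0 < c ∧ ∃ C : ℝ, 0 < C ∧ ∃ A : ℝ, 1 ≤ A ∧ ∀ 𝔠 : Ideal (𝓞 K), 𝔠 ≠ ⊥ → ∀ x : ℝ, 1 ≤ x →
      |(∑ A ∈ (smallIdeals x).filter (fun A ↦ A ⊔ 𝔠 = ⊤),
          idealMoebius A * Real.log (x / Ideal.absNorm A) / Ideal.absNorm A) -
          gamma₀⁻¹ * ∏ P ∈ (normalizedFactors 𝔠).toFinset, (1 - (Ideal.absNorm P : ℝ)⁻¹)⁻¹| ≤
        C * A ^ (Ideal.absNorm 𝔠).primeFactors.card * Real.exp (-c * Real.sqrt (Real.log x)) := by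
  classical
  obtain ⟨c, hc, C, hC, h⟩ := HeathBrown2001_moebiusSigma_bound'
  set A : ℝ := ∑' e : ℕ, ((e : ℝ) + 1) ^ Module.finrank ℚ K * ((Real.sqrt 2)⁻¹) ^ e with hA
  have hA1 : 1 ≤ A := by
    have hs := (localFactor_le (K := K) Nat.prime_two).1
    have h0 : ∀ e : ℕ, 0 ≤ ((e : ℝ) + 1) ^ Module.finrank ℚ K * ((Real.sqrt 2)⁻¹) ^ e :=
      fun e ↦ by positivity
    calc (1 : ℝ) = ((0 : ℕ) + 1 : ℝ) ^ Module.finrank ℚ K * ((Real.sqrt 2)⁻¹) ^ (0 : ℕ) := by simp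
      _ ≤ A := hs.le_tsum 0 (fun e _ ↦ h0 e)
  refine ⟨c, hc, C, hC, A, hA1, fun 𝔠 h𝔠 x hx ↦ (h 𝔠 h𝔠 x hx).trans ?_⟩
  have hB := prod_localFactor_le_pow (K := K) 𝔠
  have hE : 0 ≤ Real.exp (-c * Real.sqrt (Real.log x)) := (Real.exp_pos _).le
  gcongr

end Literature.NumberTheory.Sieve.CubicSieve

end
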